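import Literature.Probability.Percolation.OneArmSubsequentialLimits
import Literature.Probability.Percolation.ArmEventsAPriori
import HarnessLib

/-!
# The one-arm exponent: a uniform lower bound at subsequential scaling limits

Topic `Probability/Percolation`; one theorem. For every weak limit `ν` of LSW's hull laws
`lswLaw (R_k)` along `R_k → ∞`, the conformal-radius distribution function
`w_ν(t) = ν{𝔯(K) ≤ e^{-t}}` (LSW 2002, (2.2): `h(2π, t)`) is bounded below at `t = 3` by a
constant `m₀ > 0` independent of `ν` (`exists_lower_bound_confRad_subseqLimits`). Proof: by
Koebe covering (`meetsClosedBall_subset_setOf_conformalRadius_le` with the tree's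
`koebeCovering_const`), `{𝔯 ≤ e^{-3}} ⊇ {dist(0, K) ≤ r}` for `r = e^{-3}/(128π)`; by the
portmanteau inequality for this CLOSED set, `ν{dist(0,K) ≤ r} ≥ limsup_k P[C(r R_k, R_k)]`
(`lswLaw_meetsBall_eq`); and the annulus crossing event contains a one-arm event of the hexagonal
lattice (`armEvent_one_subset_triAnnulusCrossing`) whose probability is at least `c (n/N)^ζ`
uniformly (the a-priori bound `exists_rpow_le_polyArmProb_one`, Nolin 2008 Prop. 14, PROVED in
the tree from RSW). This is the lower-bound input `m₀` of `oneArm_exponent_of_neumannRenewal`.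

## References

* G. F. Lawler, O. Schramm, W. Werner, *One-arm exponent for critical 2D percolation*, Electron.
  J. Probab. 7 (2002), no. 2, §2 (2.1)–(2.2), §3. [LawlerSchrammWernerEJP2002]
* P. Nolin, *Near-critical percolation in two dimensions*, EJP 13 (2008), Prop. 14. [Nolin2008]
-/

noncomputable section

open MeasureTheory Filter Topology Metric Set TopologicalSpace
open Literature.Probability.LatticeModels Literature.Probability.Percolation
open scoped ENNReal NNReal

namespace Literature.Probability.Percolation

/-- **One-arm events cross LSW's annuli**: for `0 < r ≤ 1` and `R ≥ R₀(r)`, with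
`n = ⌊rR⌋ - 1` and `N = ⌈2R⌉`: `1 ≤ n ≤ N`, `n/N ≥ r/4`, and the hexagonal one-arm event
`armEvent ![true] n N` is contained in the open annulus crossing `C(rR, R)`
(`armEvent_one_subset_triAnnulusCrossing`: the arm runs from inside radius `n + 1 ≤ rR` to outside
radius `0.86 N ≥ R`). [folklore] -/
theorem armEvent_subset_triOpenCrossing {r R : ℝ} (hr0 : 0 < r) (hr1 : r ≤ 1)
    (hR : (8 + r) / (2 * r) + 2 / r + 1 ≤ R) :
    1 ≤ ⌊r * R⌋₊ - 1 ∧ ⌊r * R⌋₊ - 1 ≤ ⌈2 * R⌉₊ ∧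
      r / 4 ≤ ((⌊r * R⌋₊ - 1 : ℕ) : ℝ) / ((⌈2 * R⌉₊ : ℕ) : ℝ) ∧
      armEvent ![true] (⌊r * R⌋₊ - 1) ⌈2 * R⌉₊ ⊆ triOpenCrossing (r * R) R := by
  have h1 : 0 < (8 + r) / (2 * r) := by positivity
  have h2 : 0 < 2 / r := by positivity
  have hR1 : 1 ≤ R := by linarith
  have hrR2 : 2 ≤ r * R := by
    have h : 2 / r ≤ R := by linarith
    rw [div_le_iff₀ hr0] at h
    linarith
  have hrR8 : 8 + r ≤ 2 * (r * R) := by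
    have h : (8 + r) / (2 * r) ≤ R := by linarith
    rw [div_le_iff₀ (by positivity)] at h
    linarith
  have hfloor_le : (⌊r * R⌋₊ : ℝ) ≤ r * R := Nat.floor_le (by positivity)
  have hfloor_gt : r * R - 1 < (⌊r * R⌋₊ : ℝ) := Nat.sub_one_lt_floor _
  have hfl2 : 2 ≤ ⌊r * R⌋₊ := Nat.le_floor (by exact_mod_cast hrR2)
  have hn1 : 1 ≤ ⌊r * R⌋₊ - 1 := by omega
  have hncast : ((⌊r * R⌋₊ - 1 : ℕ) : ℝ) = (⌊r * R⌋₊ : ℝ) - 1 := by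
    rw [Nat.cast_sub (by omega : 1 ≤ ⌊r * R⌋₊), Nat.cast_one]
  have hceil_ge : 2 * R ≤ (⌈2 * R⌉₊ : ℝ) := Nat.le_ceil _
  have hceil_lt : (⌈2 * R⌉₊ : ℝ) < 2 * R + 1 := Nat.ceil_lt_add_one (by positivity)
  have hGpos : 0 < (⌈2 * R⌉₊ : ℝ) := by linarith
  have hnN : ⌊r * R⌋₊ - 1 ≤ ⌈2 * R⌉₊ := by
    have h : ((⌊r * R⌋₊ - 1 : ℕ) : ℝ) ≤ (⌈2 * R⌉₊ : ℝ) := by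
      rw [hncast]
      have : r * R ≤ 1 * R := mul_le_mul_of_nonneg_right hr1 (by linarith)
      linarith
    exact_mod_cast h
  have hN1 : 1 ≤ ⌈2 * R⌉₊ := hn1.trans hnN
  refine ⟨hn1, hnN, ?_, ?_⟩
  · rw [div_le_div_iff₀ (by norm_num : (0 : ℝ) < 4) hGpos, hncast]
    have hG : r * (⌈2 * R⌉₊ : ℝ) ≤ r * (2 * R + 1) := mul_le_mul_of_nonneg_left hceil_lt.le hr0.le
    nlinarith
  · refine (armEvent_one_subset_triAnnulusCrossing true hN1).trans (triAnnulusCrossing_mono ?_ ?_)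
    · rw [hncast]; linarith
    · linarith

/-- **A uniform lower bound at subsequential scaling limits**: there is `m₀ > 0` such that every
weak limit `ν` of `lswLaw (R_k)`, `R_k → ∞`, has `ν{𝔯(K) ≤ e^{-3}} ≥ m₀` (Koebe covering,
portmanteau for the closed set `{dist(0, K) ≤ r}`, and the RSW a-priori one-arm lower bound).
[cite: LawlerSchrammWernerEJP2002, §2 (2.1)–(2.2), §3] -/
theorem exists_lower_bound_confRad_subseqLimits :
    ∃ m₀ : ℝ, 0 < m₀ ∧ ∀ (R : ℕ → ℝ) (ν : ProbabilityMeasure (NonemptyCompacts ℂ)),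
      Tendsto R atTop atTop → Tendsto (lswLaw ∘ R) atTop (𝓝 ν) →
        m₀ ≤ (ν : Measure (NonemptyCompacts ℂ)).real
          {K | Literature.Analysis.Complex.conformalRadius (K : Set ℂ) ≤ Real.exp (-3)} := by
  obtain ⟨c, ζ, hc, hζ, harm⟩ := exists_rpow_le_polyArmProb_one
  have hπ := Real.pi_gt_three
  set r : ℝ := Real.exp (-3) / (128 * Real.pi) with hr
  have hr0 : 0 < r := by positivity
  have hr1 : r ≤ 1 := by
    rw [hr, div_le_one (by positivity)]
    have : Real.exp (-3) < 1 := Real.exp_lt_one_iff.2 (by norm_num)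
    linarith
  refine ⟨c * (r / 4) ^ ζ, by positivity, fun R ν hR hν ↦ ?_⟩
  -- Koebe: `{dist(0,K) ≤ r} ⊆ {𝔯 ≤ e^{-3}}`
  have hK := meetsClosedBall_subset_setOf_conformalRadius_le koebeCovering_const (by positivity) r
  have heq : (1 / (128 * Real.pi))⁻¹ * r = Real.exp (-3) := by
    rw [hr]; field_simp
  have hsub : meetsClosedBall r ⊆
      {K : NonemptyCompacts ℂ | Literature.Analysis.Complex.conformalRadius (K : Set ℂ) ≤ Real.exp (-3)} := by
    rw [← heq]; exact hK
  -- portmanteau for the closed set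
  have hport : limsup (fun k ↦ ((lswLaw ∘ R) k : Measure (NonemptyCompacts ℂ)) (meetsClosedBall r)) atTop ≤
      (ν : Measure (NonemptyCompacts ℂ)) (meetsClosedBall r) :=
    ProbabilityMeasure.limsup_measure_closed_le_of_tendsto hν (isClosed_meetsClosedBall r)
  -- the discrete lower bound, eventually
  have hev : ∀ᶠ k in atTop, ENNReal.ofReal (c * (r / 4) ^ ζ) ≤
      ((lswLaw ∘ R) k : Measure (NonemptyCompacts ℂ)) (meetsClosedBall r) := by
    filter_upwards [hR.eventually_ge_atTop ((8 + r) / (2 * r) + 2 / r + 1), hR.eventually_gt_atTop 0]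
      with k hk hk0
    obtain ⟨hn1, hnN, hratio, hsubev⟩ := armEvent_subset_triOpenCrossing hr0 hr1 hk
    have h1 : c * (r / 4) ^ ζ ≤ c * ((((⌊r * R k⌋₊ - 1 : ℕ) : ℝ)) / ((⌈2 * R k⌉₊ : ℕ) : ℝ)) ^ ζ :=
      mul_le_mul_of_nonneg_left (Real.rpow_le_rpow (by positivity) hratio hζ.le) hc.le
    have h2 := harm true _ _ hn1 hnN
    have h3 : polyArmProb ![true] (⌊r * R k⌋₊ - 1) ⌈2 * R k⌉₊ ≤
        (triSitePercolation half).real (triOpenCrossing (r * R k) (R k)) :=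
      measureReal_mono hsubev (measure_ne_top _ _)
    simp only [Function.comp_apply]
    calc ENNReal.ofReal (c * (r / 4) ^ ζ)
        ≤ ENNReal.ofReal ((triSitePercolation half).real (triOpenCrossing (r * R k) (R k))) :=
          ENNReal.ofReal_le_ofReal ((h1.trans h2).trans h3)
      _ = (lswLaw (R k) : Measure (NonemptyCompacts ℂ)) (meetsBall r) := (lswLaw_meetsBall_eq hr1 hk0).symm
      _ ≤ (lswLaw (R k) : Measure (NonemptyCompacts ℂ)) (meetsClosedBall r) :=
          measure_mono (meetsBall_subset_meetsClosedBall r)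
  have hge : ENNReal.ofReal (c * (r / 4) ^ ζ) ≤
      limsup (fun k ↦ ((lswLaw ∘ R) k : Measure (NonemptyCompacts ℂ)) (meetsClosedBall r)) atTop :=
    le_limsup_of_frequently_le hev.frequently
  have hm0 : 0 ≤ c * (r / 4) ^ ζ := by positivity
  rw [measureReal_def, ← ENNReal.toReal_ofReal hm0]
  exact ENNReal.toReal_mono (measure_ne_top _ _) ((hge.trans hport).trans (measure_mono hsub))

end Literature.Probability.Percolation
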